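import Summits.CriticalPhenomena.PercolationContinuityZ3.Theorems.BoundaryTwoArmDecay.Negative.OneArmLowerBound
import Literature.Probability.Percolation.InsertionTolerance

/-!
# `BoundaryTwoArmDecay` (crux stmt-CriticalPhenomena-0911, route `PercLowPointHalfSpace`):
# the SECOND arm is load-bearing (negative-side support, refuter cdisprove seat)

With `H = {x₀ ≥ 0}`, `e = (0,1,0)` and `P = P_{p_c(ℤ³)}` as in `OneArmLowerBound.lean`, let
`E'' r = {C_H(0) reaches sup-distance ≥ r} ∩ {0 ↮_H e}` — the crux event with the clause
"`C_H(e)` ALSO reaches distance `r`" dropped.  We prove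

* `real_E''_ge` : `P(E'' r) ≥ (1-p_c)^{6} p_c^{8} / (36 (2r+1)²)` for `r ≥ 2`, and hence
* `boundaryTwoArmDecay_false_without_second_arm` : `¬ ∃ κ > 0, C, ∀ r ≥ 1, P(E'' r) ≤ C r^{-(5/2+κ)}`.

So a proof of the crux must use that BOTH disjoint clusters are large (numerically the exponent of
`E''` is the boundary one-arm exponent `x_s ≈ 0.975`; rigorously it is `≤ 2`).

Proof.  (i) `pathIn_avoid_or_lastExit`: an open path inside `S` from `u ≠ x` to `v ≠ x` either avoids
`x` or, after its LAST visit to `x`, runs from a neighbour `w` of `x` to `v` inside `S ∖ {x}`.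
(ii) Opening the eight edges of a fixed `detour` around `e` (insertion tolerance, Bollobás–Riordan 2006
Ch. 5, in tree) turns the finite-volume arm `armBox r` into an arm inside the `e`-avoiding half-box
(`openEdges_detour_mem_armAvoid`), so `P(armAvoid r) ≥ p_c^8 · P(armBox r) ≥ p_c^8/(36(2r+1)²)`
(`OneArmLowerBound.armBox_ge`).  (iii) `armAvoid r` is determined by edges avoiding the star of `e`;
closing that star (probability `≥ (1-p_c)^6`, independent) isolates `e`, giving `E'' r`.
No route statement is asserted positively; `sorry`-free.

References: Bollobás–Riordan, Percolation (2006) Ch. 5 Lemma 2 (insertion tolerance) [BollobasRiordan2006];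
Grimmett, Percolation (1999) §1.3–1.4 [Grimmett1999].
-/

namespace Summit.CriticalPhenomena.PercolationContinuityZ3.Theorems.BoundaryTwoArmDecay.Negative

open MeasureTheory ProbabilityTheory Filter Topology
open Literature.Probability.Percolation Literature.Probability.LatticeModels
open Literature.Probability.Percolation.DCT16

noncomputable section

/-! ## A path lemma: avoid a vertex or take the last exit from it -/

/-- **Last exit.** A `G`-path inside `S` from `u ≠ x` to `v ≠ x` either stays inside `S ∖ {x}`, or some
neighbour `w` of `x` is joined to `v` inside `S ∖ {x}` (the tail after the last visit to `x`). -/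
theorem pathIn_avoid_or_lastExit {V : Type*} {G : SimpleGraph V} {S : Set V} {u v x : V}
    (h : PathIn G S u v) (hu : u ≠ x) (hv : v ≠ x) :
    PathIn G (S \ {x}) u v ∨ ∃ w, G.Adj x w ∧ PathIn G (S \ {x}) w v := by
  obtain ⟨huS, hr⟩ := h
  suffices key : ∀ v, Relation.ReflTransGen (fun a b => G.Adj a b ∧ b ∈ S) u v → v ≠ x →
      PathIn G (S \ {x}) u v ∨ ∃ w, G.Adj x w ∧ PathIn G (S \ {x}) w v from key v hr hv
  intro v hr
  induction hr with
  | refl => intro hux; exact Or.inl (PathIn.refl (Set.mem_sdiff_singleton.2 ⟨huS, hux⟩))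
  | @tail b c _ hbc ih =>
    intro hcx
    by_cases hbx : b = x
    · subst hbx
      exact Or.inr ⟨c, hbc.1, PathIn.refl (Set.mem_sdiff_singleton.2 ⟨hbc.2, hcx⟩)⟩
    · rcases ih hbx with h1 | ⟨w, hxw, hwb⟩
      · exact Or.inl (h1.tail hbc.1 (Set.mem_sdiff_singleton.2 ⟨hbc.2, hcx⟩))
      · exact Or.inr ⟨w, hxw, hwb.tail hbc.1 (Set.mem_sdiff_singleton.2 ⟨hbc.2, hcx⟩)⟩

/-! ## Stars and isolation -/

/-- The six lattice edges at a site `c` of `ℤ³`. -/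
def starAt (c : Site 3) : Finset (Sym2 (Site 3)) :=
  Finset.univ.image (fun i : Fin 3 => s(c, c + Pi.single i 1)) ∪
    Finset.univ.image (fun i : Fin 3 => s(c, c - Pi.single i 1))

/-- A lattice edge at `c` belongs to `starAt c`. -/
theorem mem_starAt_of_adj {c v : Site 3} (h : (zdGraph 3).Adj c v) : s(c, v) ∈ starAt c := by
  obtain ⟨i, hv | hv⟩ := (zdGraph_adj_iff c v).1 h
  · rw [hv]
    exact Finset.mem_union.2 (Or.inl (Finset.mem_image_of_mem _ (Finset.mem_univ i)))
  · have : v = c - Pi.single i 1 := eq_sub_of_add_eq hv.symm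
    rw [this]
    exact Finset.mem_union.2 (Or.inr (Finset.mem_image_of_mem _ (Finset.mem_univ i)))

/-- Closing the star of `c` isolates `c`: no open path inside any `S` joins `c` to `y ≠ c`
(for configurations using lattice edges only). -/
theorem not_openConnIn_of_starAt_closed {ω : BondConfig (Site 3)} (hω : ω ⊆ (zdGraph 3).edgeSet)
    {c : Site 3} (hc : ∀ f ∈ starAt c, f ∉ ω) {S : Set (Site 3)} {y : Site 3} (hy : y ≠ c) :
    ω ∉ openConnIn S c y := by
  intro h
  have hp := pathIn_of_mem_openConnIn h
  have key : y = c := by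
    refine pathIn_induction (fun v => v = c) hp rfl ?_
    intro a b _ _ hac hab
    rw [hac] at hab
    have h1 := (openGraph_adj _ _ _).1 hab
    have hadj : (zdGraph 3).Adj c b := by simpa [SimpleGraph.mem_edgeSet] using hω h1.1
    exact (hc _ (mem_starAt_of_adj hadj) h1.1).elim
  exact hy key

/-! ## The `e`-avoiding half-box and the detour -/

/-- The half-box with the root `e` removed. -/
def avoidBox (r : ℕ) : Finset (Site 3) := (halfBox r).erase e

/-- The `e`-avoiding finite-volume arm event. -/
def armAvoid (r : ℕ) : Set (BondConfig (Site 3)) := openCrossing (↑(avoidBox r)) {0} (far r)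

/-- `↑(avoidBox r) = ↑(halfBox r) ∖ {e}`. -/
theorem coe_avoidBox (r : ℕ) : (↑(avoidBox r) : Set (Site 3)) = ↑(halfBox r) \ {e} := by
  rw [avoidBox, Finset.coe_erase]

/-- Small sites of `H` other than `e` lie in the avoiding box once `r ≥ 1`. -/
theorem mem_avoidBox_of_small {r : ℕ} (hr : 1 ≤ r) {v : Site 3} (h0 : 0 ≤ v 0)
    (hv : ∀ i, |v i| ≤ 2) (hne : v ≠ e) : v ∈ (↑(avoidBox r) : Set (Site 3)) := by
  rw [coe_avoidBox]
  refine Set.mem_sdiff_singleton.2 ⟨?_, hne⟩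
  rw [Finset.mem_coe, halfBox, Finset.mem_filter, mem_box]
  refine ⟨fun i => ?_, h0⟩
  have := hv i
  rw [abs_le] at this
  push_cast
  omega

/-- Eight lattice edges forming detours inside `H ∖ {e}` from `0` to the `H`-neighbours of `e`:
`0–(0,0,1)–(0,1,1)–(0,2,1)–(0,2,0)`, `0–(0,0,-1)–(0,1,-1)`, `0–(1,0,0)–(1,1,0)`. -/
def detour : Finset (Sym2 (Site 3)) :=
  {s((0 : Site 3), ![0, 0, 1]), s((![0, 0, 1] : Site 3), ![0, 1, 1]), s((![0, 1, 1] : Site 3), ![0, 2, 1]),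
    s((![0, 2, 1] : Site 3), ![0, 2, 0]), s((0 : Site 3), ![0, 0, -1]), s((![0, 0, -1] : Site 3), ![0, 1, -1]),
    s((0 : Site 3), ![1, 0, 0]), s((![1, 0, 0] : Site 3), ![1, 1, 0])}

/-- The detour edges are lattice edges. -/
theorem detour_subset_edgeSet : (↑detour : Set (Sym2 (Site 3))) ⊆ (zdGraph 3).edgeSet := by
  intro f hf
  simp only [detour, Finset.coe_insert, Finset.coe_singleton, Set.mem_insert_iff,
    Set.mem_singleton_iff] at hf
  rcases hf with rfl | rfl | rfl | rfl | rfl | rfl | rfl | rfl <;>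
    exact (SimpleGraph.mem_edgeSet _).2 (by decide)

/-- `e = (0,1,0)` in vector notation. -/
theorem e_eq_vec : e = ![0, 1, 0] := by decide

/-- One detour step: an edge of `detour` between sites of the avoiding box is an open step of
`openGraph (ω ∪ detour)`. -/
theorem detour_step {ω : BondConfig (Site 3)} {u v : Site 3} (huv : s(u, v) ∈ detour) (hne : u ≠ v) :
    (openGraph (ω ∪ ↑detour)).Adj u v :=
  (openGraph_adj _ _ _).2 ⟨Set.mem_union_right _ (Finset.mem_coe.2 huv), hne⟩

/-- **Detours.** For every `H`-neighbour `w` of `e` inside the avoiding box there is an open path of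
`ω ∪ detour` from `0` to `w` inside the avoiding box (`r ≥ 1`). -/
theorem detourPath {r : ℕ} (hr : 1 ≤ r) (ω : BondConfig (Site 3)) {w : Site 3}
    (hw : (zdGraph 3).Adj e w) (hwA : w ∈ (↑(avoidBox r) : Set (Site 3))) :
    PathIn (openGraph (ω ∪ ↑detour)) (↑(avoidBox r)) 0 w := by
  have h0 : (0 : Site 3) ∈ (↑(avoidBox r) : Set (Site 3)) :=
    mem_avoidBox_of_small hr (by decide) (by decide) (by decide)
  have ha1 : (![0, 0, 1] : Site 3) ∈ (↑(avoidBox r) : Set (Site 3)) :=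
    mem_avoidBox_of_small hr (by decide) (by decide) (by decide)
  have ha2 : (![0, 1, 1] : Site 3) ∈ (↑(avoidBox r) : Set (Site 3)) :=
    mem_avoidBox_of_small hr (by decide) (by decide) (by decide)
  have ha3 : (![0, 2, 1] : Site 3) ∈ (↑(avoidBox r) : Set (Site 3)) :=
    mem_avoidBox_of_small hr (by decide) (by decide) (by decide)
  have ha4 : (![0, 2, 0] : Site 3) ∈ (↑(avoidBox r) : Set (Site 3)) :=
    mem_avoidBox_of_small hr (by decide) (by decide) (by decide)
  have hb1 : (![0, 0, -1] : Site 3) ∈ (↑(avoidBox r) : Set (Site 3)) :=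
    mem_avoidBox_of_small hr (by decide) (by decide) (by decide)
  have hb2 : (![0, 1, -1] : Site 3) ∈ (↑(avoidBox r) : Set (Site 3)) :=
    mem_avoidBox_of_small hr (by decide) (by decide) (by decide)
  have hc1 : (![1, 0, 0] : Site 3) ∈ (↑(avoidBox r) : Set (Site 3)) :=
    mem_avoidBox_of_small hr (by decide) (by decide) (by decide)
  have hc2 : (![1, 1, 0] : Site 3) ∈ (↑(avoidBox r) : Set (Site 3)) :=
    mem_avoidBox_of_small hr (by decide) (by decide) (by decide)
  -- the paths
  have pA1 : PathIn (openGraph (ω ∪ ↑detour)) (↑(avoidBox r)) 0 ![0, 0, 1] :=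
    (PathIn.refl h0).tail (detour_step (by decide) (by decide)) ha1
  have pA2 : PathIn (openGraph (ω ∪ ↑detour)) (↑(avoidBox r)) 0 ![0, 1, 1] :=
    pA1.tail (detour_step (by decide) (by decide)) ha2
  have pA4 : PathIn (openGraph (ω ∪ ↑detour)) (↑(avoidBox r)) 0 ![0, 2, 0] :=
    (pA2.tail (detour_step (by decide) (by decide)) ha3).tail (detour_step (by decide) (by decide)) ha4
  have pB2 : PathIn (openGraph (ω ∪ ↑detour)) (↑(avoidBox r)) 0 ![0, 1, -1] :=
    ((PathIn.refl h0).tail (detour_step (by decide) (by decide)) hb1).tail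
      (detour_step (by decide) (by decide)) hb2
  have pC2 : PathIn (openGraph (ω ∪ ↑detour)) (↑(avoidBox r)) 0 ![1, 1, 0] :=
    ((PathIn.refl h0).tail (detour_step (by decide) (by decide)) hc1).tail
      (detour_step (by decide) (by decide)) hc2
  -- enumerate the neighbours of e
  obtain ⟨i, hi | hi⟩ := (zdGraph_adj_iff e w).1 hw
  · fin_cases i
    · have : w = ![1, 1, 0] := by rw [hi]; decide
      rw [this]; exact pC2
    · have : w = ![0, 2, 0] := by rw [hi]; decide
      rw [this]; exact pA4
    · have : w = ![0, 1, 1] := by rw [hi]; decide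
      rw [this]; exact pA2
  · have hw' : w = e - Pi.single i 1 := eq_sub_of_add_eq hi.symm
    fin_cases i
    · -- w = (-1,1,0) is not in H
      exfalso
      have : w = ![-1, 1, 0] := by rw [hw']; decide
      rw [this, coe_avoidBox] at hwA
      have h2 := (Set.mem_sdiff_singleton.1 hwA).1
      rw [Finset.mem_coe, halfBox, Finset.mem_filter] at h2
      have h3 := h2.2
      simp at h3
    · have : w = 0 := by rw [hw']; decide
      rw [this]; exact PathIn.refl h0
    · have : w = ![0, 1, -1] := by rw [hw']; decide
      rw [this]; exact pB2

/-- **Opening the detour reroutes the arm around `e`.** For `r ≥ 2` and `ω` using lattice edges only,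
`ω ∈ armBox r` implies `ω ∪ detour ∈ armAvoid r`. -/
theorem openEdges_detour_mem_armAvoid {r : ℕ} (hr : 2 ≤ r) {ω : BondConfig (Site 3)}
    (hω : ω ⊆ (zdGraph 3).edgeSet) (h : ω ∈ armBox r) : ω ∪ ↑detour ∈ armAvoid r := by
  obtain ⟨a, ha, b, hb, hab⟩ := h
  rw [Set.mem_singleton_iff] at ha
  subst ha
  have hbe : b ≠ e := by
    rintro rfl
    obtain ⟨i, hi⟩ := hb
    have : |e i| ≤ 1 := by
      rw [e_eq_vec]; fin_cases i <;> simp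
    omega
  have he0 : (0 : Site 3) ≠ e := by decide
  have hp : PathIn (openGraph (ω ∪ ↑detour)) (↑(halfBox r)) 0 b :=
    (pathIn_of_mem_openConnIn hab).mono_graph (openGraph_mono Set.subset_union_left)
  rcases pathIn_avoid_or_lastExit hp he0 hbe with h1 | ⟨w, hew, hwb⟩
  · refine ⟨0, rfl, b, hb, mem_openConnIn_of_pathIn ?_⟩
    rwa [coe_avoidBox]
  · have hω' : ω ∪ ↑detour ⊆ (zdGraph 3).edgeSet := Set.union_subset hω detour_subset_edgeSet
    have hadj : (zdGraph 3).Adj e w := by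
      have := (openGraph_adj _ _ _).1 hew
      simpa [SimpleGraph.mem_edgeSet] using hω' this.1
    rw [← coe_avoidBox] at hwb
    have hwA : w ∈ (↑(avoidBox r) : Set (Site 3)) := hwb.left_mem
    exact ⟨0, rfl, b, hb, mem_openConnIn_of_pathIn ((detourPath (by omega) ω hadj hwA).trans hwb)⟩

/-! ## Probabilities -/

/-- `armAvoid r` is measurable. -/
theorem measurableSet_armAvoid (r : ℕ) : MeasurableSet (armAvoid r) := by
  have h : armAvoid r = ⋃ y ∈ far r, openConnIn (↑(avoidBox r) : Set (Site 3)) 0 y := by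
    ext ω; simp [armAvoid, openCrossing]
  rw [h]
  exact MeasurableSet.biUnion (Set.to_countable _) fun y _ => measurableSet_openConnIn (avoidBox r) 0 y

/-- `armAvoid r` is determined by the pairs of sites of the avoiding box. -/
theorem determinedBy_armAvoid (r : ℕ) :
    DeterminedBy (armAvoid r) (↑(avoidBox r).sym2 : Set (Sym2 (Site 3))) := by
  rw [determinedBy_iff]
  intro ω ω' hω
  have hK : ∀ y, (ω ∈ openConnIn (↑(avoidBox r) : Set (Site 3)) 0 y ↔
      ω' ∈ openConnIn (↑(avoidBox r) : Set (Site 3)) 0 y) := fun y =>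
    (determinedBy_iff _ _).1 (determinedBy_openConnIn (↑(avoidBox r) : Set (Site 3)) 0 y
      (K := ↑(avoidBox r).sym2) (by rw [Finset.coe_sym2])) ω ω' hω
  simp only [armAvoid, mem_openCrossing_iff, Set.mem_singleton_iff]
  constructor
  · rintro ⟨a, rfl, y, hy, h⟩; exact ⟨0, rfl, y, hy, (hK y).1 h⟩
  · rintro ⟨a, rfl, y, hy, h⟩; exact ⟨0, rfl, y, hy, (hK y).2 h⟩

/-- **The avoiding arm is not rare**: `P(armAvoid r) ≥ p_c^8 / (36 (2r+1)²)` for `r ≥ 2`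
(insertion tolerance for the detour + `armBox_ge`). -/
theorem armAvoid_ge {r : ℕ} (hr : 2 ≤ r) :
    ((criticalProbI 3 : unitInterval) : ℝ) ^ detour.card / (36 * (2 * (r : ℝ) + 1) ^ 2) ≤
      μ.real (armAvoid r) := by
  have h1 := bondPercolation_pow_mul_real_preimage_openEdges_le (zdGraph 3) (criticalProbI 3) detour
    detour_subset_edgeSet (measurableSet_armAvoid r)
  have h2 : μ.real (armBox r) ≤ μ.real (openEdges ↑detour ⁻¹' armAvoid r) :=
    real_mono_of_forall_subset_edgeSet (zdGraph 3) _ fun ω hω h =>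
      openEdges_detour_mem_armAvoid hr hω h
  have h3 := armBox_ge r
  have hp0 : 0 ≤ ((criticalProbI 3 : unitInterval) : ℝ) ^ detour.card := pow_nonneg (criticalProbI 3).2.1 _
  calc ((criticalProbI 3 : unitInterval) : ℝ) ^ detour.card / (36 * (2 * (r : ℝ) + 1) ^ 2)
      = ((criticalProbI 3 : unitInterval) : ℝ) ^ detour.card * (1 / (36 * (2 * (r : ℝ) + 1) ^ 2)) := by ring
    _ ≤ ((criticalProbI 3 : unitInterval) : ℝ) ^ detour.card * μ.real (openEdges ↑detour ⁻¹' armAvoid r) :=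
        mul_le_mul_of_nonneg_left (h3.trans h2) hp0
    _ ≤ μ.real (armAvoid r) := h1

/-- The crux event with the SECOND arm dropped: `C_H(0)` reaches distance `r` and `0 ↮_H e`. -/
def E'' (r : ℕ) : Set (BondConfig (Site 3)) :=
  {ω | (∃ y : Site 3, (∃ i : Fin 3, (r : ℤ) ≤ |y i|) ∧ ω ∈ openConnIn H 0 y) ∧ ω ∉ openConnIn H 0 e}

/-- The avoiding box lies in `H`. -/
theorem avoidBox_subset_H (r : ℕ) : (↑(avoidBox r) : Set (Site 3)) ⊆ H := by
  rw [coe_avoidBox]; exact Set.sdiff_subset.trans (halfBox_subset_H r)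

/-- `armAvoid r ∩ {star of e closed} ⊆ E'' r` for configurations on lattice edges. -/
theorem mem_E''_of_armAvoid_of_star_closed {r : ℕ} {ω : BondConfig (Site 3)} (hω : ω ⊆ (zdGraph 3).edgeSet)
    (h : ω ∈ armAvoid r ∩ {ω | ∀ f ∈ starAt e, f ∉ ω}) : ω ∈ E'' r := by
  obtain ⟨⟨a, ha, y, hy, hay⟩, hstar⟩ := h
  rw [Set.mem_singleton_iff] at ha
  subst ha
  refine ⟨⟨y, hy, openConnIn_mono' (avoidBox_subset_H r) _ _ hay⟩, ?_⟩
  rw [openConnIn_comm']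
  exact not_openConnIn_of_starAt_closed hω hstar (by decide)

/-- The star of `e` avoids the pairs of the avoiding box. -/
theorem disjoint_sym2_starAt (r : ℕ) :
    Disjoint (↑(avoidBox r).sym2 : Set (Sym2 (Site 3))) ↑(starAt e) := by
  rw [Set.disjoint_right]
  intro f hf hK
  rw [Finset.mem_coe, starAt, Finset.mem_union, Finset.mem_image, Finset.mem_image] at hf
  have he : e ∉ avoidBox r := Finset.notMem_erase e _
  rcases hf with ⟨i, -, rfl⟩ | ⟨i, -, rfl⟩ <;>
    · rw [Finset.mem_coe, Finset.mk_mem_sym2_iff] at hK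
      exact he hK.1

/-- **Lower bound for the one-sided event**: for `r ≥ 2`,
`P(E'' r) ≥ (1 - p_c)^{|star e|} p_c^{|detour|} / (36 (2r+1)²)`. -/
theorem real_E''_ge {r : ℕ} (hr : 2 ≤ r) :
    (1 - ((criticalProbI 3 : unitInterval) : ℝ)) ^ (starAt e).card *
        (((criticalProbI 3 : unitInterval) : ℝ) ^ detour.card / (36 * (2 * (r : ℝ) + 1) ^ 2)) ≤
      μ.real (E'' r) := by
  set C : Set (BondConfig (Site 3)) := {ω | ∀ f ∈ starAt e, f ∉ ω} with hC
  have hind : μ.real (armAvoid r ∩ C) = μ.real (armAvoid r) * μ.real C :=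
    bondPercolation_real_inter_of_disjoint (zdGraph 3) (criticalProbI 3) (disjoint_sym2_starAt r)
      (determinedBy_armAvoid r) (determinedBy_forall_notMem (starAt e)) (measurableSet_armAvoid r)
      (measurableSet_forall_notMem (starAt e))
  have hCge : (1 - ((criticalProbI 3 : unitInterval) : ℝ)) ^ (starAt e).card ≤ μ.real C :=
    le_bondPercolation_real_forall_notMem (zdGraph 3) (criticalProbI 3) (starAt e)
  have hA := armAvoid_ge hr
  have hsub : μ.real (armAvoid r ∩ C) ≤ μ.real (E'' r) :=
    real_mono_of_forall_subset_edgeSet (zdGraph 3) _ fun ω hω h =>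
      mem_E''_of_armAvoid_of_star_closed hω h
  have hq0 : 0 ≤ ((criticalProbI 3 : unitInterval) : ℝ) ^ detour.card / (36 * (2 * (r : ℝ) + 1) ^ 2) :=
    div_nonneg (pow_nonneg (criticalProbI 3).2.1 _) (by positivity)
  calc (1 - ((criticalProbI 3 : unitInterval) : ℝ)) ^ (starAt e).card *
        (((criticalProbI 3 : unitInterval) : ℝ) ^ detour.card / (36 * (2 * (r : ℝ) + 1) ^ 2))
      ≤ μ.real C * μ.real (armAvoid r) :=
        mul_le_mul hCge hA hq0 measureReal_nonneg
    _ = μ.real (armAvoid r ∩ C) := by rw [hind, mul_comm]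
    _ ≤ μ.real (E'' r) := hsub

/-- **No power decay beyond 2 from an inverse-square lower bound** (the arithmetic shared by the
one-sided refutations): if `f r ≥ c/(36(2r+1)²)` for `r ≥ 2` with `c > 0`, then `f` is not
`O(r^{-(5/2+κ)})` on `r ≥ 1` for any `κ > 0`. -/
theorem not_decay_of_inv_sq_lower {f : ℕ → ℝ} {c : ℝ} (hc : 0 < c)
    (hlow : ∀ r : ℕ, 2 ≤ r → c / (36 * (2 * (r : ℝ) + 1) ^ 2) ≤ f r) :
    ¬ ∃ κ C : ℝ, 0 < κ ∧ ∀ r : ℕ, 1 ≤ r → f r ≤ C * (r : ℝ) ^ (-(5 / 2 + κ)) := by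
  rintro ⟨κ, C, hκ, h⟩
  have hb : 0 < 1 / 2 + κ := by linarith
  have hM0 : 0 ≤ 324 * |C| / c := div_nonneg (by positivity) hc.le
  obtain ⟨r, hr1, hr⟩ := exists_nat_rpow_gt hb (324 * |C| / c + 1)
  have hr2 : 2 ≤ r := by
    by_contra hlt
    have : r = 1 := by omega
    subst this
    simp at hr
    linarith
  have hr0 : (0 : ℝ) < r := by exact_mod_cast (show 0 < r by omega)
  have hr1' : (1 : ℝ) ≤ r := by exact_mod_cast hr1
  have hup := (hlow r hr2).trans (h r hr1)
  have hrpow_pos : 0 < (r : ℝ) ^ (-(5 / 2 + κ)) := Real.rpow_pos_of_pos hr0 _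
  have hCabs : C * (r : ℝ) ^ (-(5 / 2 + κ)) ≤ |C| * (r : ℝ) ^ (-(5 / 2 + κ)) :=
    mul_le_mul_of_nonneg_right (le_abs_self C) hrpow_pos.le
  have h9 : (2 * (r : ℝ) + 1) ^ 2 ≤ 9 * (r : ℝ) ^ (2 : ℝ) := by
    rw [Real.rpow_two]; nlinarith
  have hsplit : (r : ℝ) ^ (2 : ℝ) * (r : ℝ) ^ (-(5 / 2 + κ)) = ((r : ℝ) ^ (1 / 2 + κ))⁻¹ := by
    rw [← Real.rpow_add hr0, ← Real.rpow_neg hr0.le]; congr 1; ring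
  have hpow_pos : 0 < (r : ℝ) ^ (1 / 2 + κ) := Real.rpow_pos_of_pos hr0 _
  have key : c ≤ 324 * |C| * ((r : ℝ) ^ (1 / 2 + κ))⁻¹ := by
    have h1 := hup.trans hCabs
    rw [div_le_iff₀ (by positivity)] at h1
    calc c ≤ |C| * (r : ℝ) ^ (-(5 / 2 + κ)) * (36 * (2 * (r : ℝ) + 1) ^ 2) := h1
      _ ≤ |C| * (r : ℝ) ^ (-(5 / 2 + κ)) * (36 * (9 * (r : ℝ) ^ (2 : ℝ))) := by gcongr
      _ = 324 * |C| * ((r : ℝ) ^ (2 : ℝ) * (r : ℝ) ^ (-(5 / 2 + κ))) := by ring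
      _ = 324 * |C| * ((r : ℝ) ^ (1 / 2 + κ))⁻¹ := by rw [hsplit]
  rw [← div_eq_mul_inv, le_div_iff₀ hpow_pos] at key
  -- key : c * r^{1/2+κ} ≤ 324 |C| ;  hr : 324|C|/c + 1 < r^{1/2+κ}
  have hr' : 324 * |C| / c < (r : ℝ) ^ (1 / 2 + κ) := by linarith
  rw [div_lt_iff₀ hc] at hr'
  linarith [mul_comm c ((r : ℝ) ^ (1 / 2 + κ))]

/-- **The second arm is load-bearing**: dropping "`C_H(e)` reaches distance `r`" from the crux makes it
FALSE.  (The landed twin `boundaryTwoArmDecay_false_without_disjoint` drops the disjointness instead.) -/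
theorem boundaryTwoArmDecay_false_without_second_arm :
    ¬ ∃ κ C : ℝ, 0 < κ ∧ ∀ r : ℕ, 1 ≤ r → μ.real (E'' r) ≤ C * (r : ℝ) ^ (-(5 / 2 + κ)) := by
  have hpc := Grimmett1999_criticalProb_pos_lt_one_holds 3 (by norm_num)
  have hpc0 : 0 < ((criticalProbI 3 : unitInterval) : ℝ) := hpc.1
  have hpc1 : ((criticalProbI 3 : unitInterval) : ℝ) < 1 := hpc.2
  refine not_decay_of_inv_sq_lower (c := (1 - ((criticalProbI 3 : unitInterval) : ℝ)) ^ (starAt e).card *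
    ((criticalProbI 3 : unitInterval) : ℝ) ^ detour.card) (mul_pos (pow_pos (by linarith) _) (pow_pos hpc0 _)) ?_
  intro r hr
  have := real_E''_ge hr
  rwa [mul_div_assoc]

end

end Summit.CriticalPhenomena.PercolationContinuityZ3.Theorems.BoundaryTwoArmDecay.Negative
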